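import Mathlib

/-!
# SoloBlind — two-branch linearisation: the algebraic skeleton of Theorem B (session 9, paper §15)

Context (solo-blind programme on `ResolutionOfSingularities`, W-side, surface model BU₂).  Let `σ` be an
automorphism of `B = k[[x,y]]` (`char k = p`) for which both axes are `σ`-stable, and put
`σ(x) = x(1+ξ)`, `σ(y) = y(1+η)` with `ξ, η` in the maximal ideal.  Along any chain of *satellite*
blow-ups the local coordinates are monomials `x_k = x^α y^β`, `y_k = x^γ y^δ` (rows of a unimodular
integer matrix), and the fixed ideal at the `k`-th centre is generated by
`x_k · ((1+ξ)^α (1+η)^β − 1)` and `y_k · ((1+ξ)^γ (1+η)^δ − 1)`.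
Theorem B of the programme notes (§15: satellite tails and fixed-branch tails of a bad chain are finite)
rests on the following purely algebraic facts, proved here sorry-free:

* `one_add_pow_sub_one_eq_mul_geom_sum`, `geom_sum_one_add_sub_natCast_mem_span` — for any `w`,
  `(1+w)^m − 1 = w · S_m(w)` with `S_m(w) ≡ m (mod w)`;
* `one_add_pow_prime_pow_mul_sub_one` — in characteristic `p`,
  `(1+z)^(p^s·m) − 1 = z^(p^s) · S_m(z^(p^s))` (Frobenius + geometric sum);
* `isUnit_geom_sum_one_add` — in a local ring, `S_m(w)` is a unit when `w ∈ 𝔪` and `m` is a unit;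
  hence (`exists_unit_one_add_pow_sub_one`) **one-branch linearisation**: for `z ∈ 𝔪` and `p ∤ m`,
  `(1+z)^(p^s·m) − 1 = z^(p^s) · (unit)` — the fixed ideal along a stable branch only sees the
  `p`-adic valuation of the exponent;
* `two_branch_split`, `exists_units_two_branch` — **two-branch linearisation**:
  `(1+ξ)^a (1+η)^b − 1 = ((1+ξ)^a − 1) + (1+ξ)^a ((1+η)^b − 1) = ξ^(p^s)·U₁ + η^(p^t)·U₂` with units
  `U₁, U₂` when `a = p^s m`, `b = p^t m'`, `p ∤ m m'`;
* `isCoprime_row_of_det`, `not_dvd_both_of_det` — rows of a unimodular integer matrix are primitive and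
  a prime never divides both entries of a column (used: at most one row of the chart matrix is
  "resonant", §15.3);
* `span_pair_le_span_of_dvd` — the divisibility certificate of Lemma 15.1: if `δx = x·ξ` and `ξ ∣ δy`
  then the fixed ideal `(δx, δy)` lies in `(ξ)` (so `e = ξ`, `s = x` is a Totaro certificate);
* `units_inv_pow_sub_one` — negative exponents change `(1+ξ)^c − 1` by a unit only.
-/

namespace Summit.ResolutionOfSingularities.ResolutionOfSingularities.Theorems.SoloBlind

open Finset

section GeomSum

variable {R : Type*} [CommRing R]

/-- `(1+w)^m − 1 = w · ∑_{i<m} (1+w)^i`. -/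
theorem one_add_pow_sub_one_eq_mul_geom_sum (w : R) (m : ℕ) :
    (1 + w) ^ m - 1 = w * ∑ i ∈ range m, (1 + w) ^ i := by
  have h := geom_sum_mul (1 + w) m
  rw [add_sub_cancel_left] at h
  rw [← h, mul_comm]

/-- `∑_{i<m} (1+w)^i ≡ m (mod w)`. -/
theorem geom_sum_one_add_sub_natCast_mem_span (w : R) (m : ℕ) :
    (∑ i ∈ range m, (1 + w) ^ i) - (m : R) ∈ Ideal.span {w} := by
  induction m with
  | zero => simp
  | succ m ih =>
    have h1 : (1 + w) ^ m - 1 ∈ Ideal.span {w} := by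
      rw [one_add_pow_sub_one_eq_mul_geom_sum]
      exact Ideal.mul_mem_right _ _ (Ideal.mem_span_singleton_self w)
    have : (∑ i ∈ range (m + 1), (1 + w) ^ i) - ((m + 1 : ℕ) : R)
        = ((∑ i ∈ range m, (1 + w) ^ i) - (m : R)) + ((1 + w) ^ m - 1) := by
      rw [sum_range_succ]; push_cast; ring
    rw [this]
    exact Ideal.add_mem _ ih h1

/-- The two-branch split (a ring identity). -/
theorem two_branch_split (ξ η : R) (a b : ℕ) :
    (1 + ξ) ^ a * (1 + η) ^ b - 1 = ((1 + ξ) ^ a - 1) + (1 + ξ) ^ a * ((1 + η) ^ b - 1) := by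
  ring

/-- Lemma 15.1 (divisibility certificate): if `δx = x ξ` and `ξ ∣ δy`, the ideal `(δx, δy)` lies in `(ξ)`. -/
theorem span_pair_le_span_of_dvd (x ξ δx δy : R) (hx : δx = x * ξ) (hy : ξ ∣ δy) :
    Ideal.span {δx, δy} ≤ Ideal.span {ξ} := by
  rw [Ideal.span_le]
  intro z hz
  simp only [Set.mem_insert_iff, Set.mem_singleton_iff] at hz
  rcases hz with rfl | rfl
  · rw [hx]
    exact Ideal.mul_mem_left _ _ (Ideal.mem_span_singleton_self ξ)
  · exact Ideal.mem_span_singleton.mpr hy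

end GeomSum

section CharP

variable {R : Type*} [CommRing R] (p : ℕ) [Fact p.Prime] [CharP R p]

/-- Frobenius + geometric sum: `(1+z)^(p^s·m) − 1 = z^(p^s) · ∑_{i<m} (1 + z^(p^s))^i`. -/
theorem one_add_pow_prime_pow_mul_sub_one (z : R) (s m : ℕ) :
    (1 + z) ^ (p ^ s * m) - 1 = z ^ p ^ s * ∑ i ∈ range m, (1 + z ^ p ^ s) ^ i := by
  have hfrob : (1 + z) ^ p ^ s = 1 + z ^ p ^ s := by
    have := add_pow_char_pow (1 : R) z p s
    simpa using this
  rw [pow_mul, hfrob]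
  exact one_add_pow_sub_one_eq_mul_geom_sum _ _

/-- In characteristic `p`, a natural number prime to `p` is a unit. -/
theorem isUnit_natCast_of_not_dvd {m : ℕ} (hm : ¬ p ∣ m) : IsUnit (m : R) :=
  (CharP.isUnit_natCast_iff (R := R) (Fact.out : p.Prime)).mpr hm

end CharP

section Local

variable {R : Type*} [CommRing R] [IsLocalRing R]

/-- In a local ring: if `w ∈ 𝔪` and `m` is a unit of `R`, then `∑_{i<m} (1+w)^i` is a unit. -/
theorem isUnit_geom_sum_one_add {w : R} (hw : w ∈ IsLocalRing.maximalIdeal R) {m : ℕ}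
    (hm : IsUnit (m : R)) : IsUnit (∑ i ∈ range m, (1 + w) ^ i) := by
  rw [← IsLocalRing.notMem_maximalIdeal]
  intro hS
  have hdiff : (∑ i ∈ range m, (1 + w) ^ i) - (m : R) ∈ IsLocalRing.maximalIdeal R := by
    have h := geom_sum_one_add_sub_natCast_mem_span w m
    have hle : Ideal.span {w} ≤ IsLocalRing.maximalIdeal R := by
      rw [Ideal.span_le, Set.singleton_subset_iff]; exact hw
    exact hle h
  have hmmem : (m : R) ∈ IsLocalRing.maximalIdeal R := by
    simpa using Ideal.sub_mem _ hS hdiff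
  exact (IsLocalRing.notMem_maximalIdeal.mpr hm) hmmem

variable (p : ℕ) [Fact p.Prime] [CharP R p]

/-- **One-branch linearisation.**  In a local ring of characteristic `p`: for `z ∈ 𝔪` and `p ∤ m`,
`(1+z)^(p^s·m) − 1 = z^(p^s) · u` with `u` a unit.  (Along a `σ`-stable branch the fixed ideal of
`σ^n` — or of `σ` in the `n`-th satellite chart — only sees `v_p(n)`.) -/
theorem exists_unit_one_add_pow_sub_one {z : R} (hz : z ∈ IsLocalRing.maximalIdeal R)
    (s : ℕ) {m : ℕ} (hm : ¬ p ∣ m) :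
    ∃ u : R, IsUnit u ∧ (1 + z) ^ (p ^ s * m) - 1 = z ^ p ^ s * u := by
  refine ⟨∑ i ∈ range m, (1 + z ^ p ^ s) ^ i, ?_, one_add_pow_prime_pow_mul_sub_one p z s m⟩
  apply isUnit_geom_sum_one_add
  · exact Ideal.pow_mem_of_mem _ hz _ (pow_pos (Fact.out : p.Prime).pos s)
  · exact isUnit_natCast_of_not_dvd p hm

/-- **Two-branch linearisation.**  In a local ring of characteristic `p`, for `ξ, η ∈ 𝔪` and
exponents `a = p^s m`, `b = p^t m'` with `p ∤ m`, `p ∤ m'`: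
`(1+ξ)^a (1+η)^b − 1 = ξ^(p^s) U₁ + η^(p^t) U₂` with units `U₁, U₂`. -/
theorem exists_units_two_branch {ξ η : R} (hξ : ξ ∈ IsLocalRing.maximalIdeal R)
    (hη : η ∈ IsLocalRing.maximalIdeal R) (s t : ℕ) {m m' : ℕ} (hm : ¬ p ∣ m) (hm' : ¬ p ∣ m') :
    ∃ U₁ U₂ : R, IsUnit U₁ ∧ IsUnit U₂ ∧
      (1 + ξ) ^ (p ^ s * m) * (1 + η) ^ (p ^ t * m') - 1 = ξ ^ p ^ s * U₁ + η ^ p ^ t * U₂ := by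
  obtain ⟨u₁, hu₁, h₁⟩ := exists_unit_one_add_pow_sub_one p hξ s hm
  obtain ⟨u₂, hu₂, h₂⟩ := exists_unit_one_add_pow_sub_one p hη t hm'
  have hunit : IsUnit ((1 + ξ) ^ (p ^ s * m)) := by
    apply IsUnit.pow
    rw [← IsLocalRing.notMem_maximalIdeal]
    intro h
    have : (1 : R) ∈ IsLocalRing.maximalIdeal R := by
      simpa using Ideal.sub_mem _ h hξ
    exact (Ideal.ne_top_iff_one _).mp (Ideal.IsMaximal.ne_top inferInstance) this
  refine ⟨u₁, (1 + ξ) ^ (p ^ s * m) * u₂, hu₁, hunit.mul hu₂, ?_⟩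
  rw [two_branch_split, h₁, h₂]
  ring

end Local

section Unimodular

/-- Rows of a unimodular integer matrix are primitive. -/
theorem isCoprime_row_of_det {α β γ δ : ℤ} {ε : ℤ} (hε : ε = 1 ∨ ε = -1)
    (h : α * δ - β * γ = ε) : IsCoprime α β := by
  rcases hε with rfl | rfl
  · exact ⟨δ, -γ, by linear_combination h⟩
  · exact ⟨-δ, γ, by linear_combination -h⟩

/-- A prime (indeed any non-unit) never divides both entries of a column of a unimodular matrix. -/
theorem not_dvd_both_of_det {α β γ δ : ℤ} {ε : ℤ} (hε : ε = 1 ∨ ε = -1)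
    (h : α * δ - β * γ = ε) {q : ℤ} (hq : ¬ IsUnit q) : ¬ (q ∣ α ∧ q ∣ γ) := by
  rintro ⟨⟨a, rfl⟩, ⟨c, rfl⟩⟩
  apply hq
  have hdvd : q ∣ ε := ⟨a * δ - β * c, by rw [← h]; ring⟩
  rcases hε with rfl | rfl
  · exact isUnit_of_dvd_one hdvd
  · exact isUnit_of_dvd_one (by simpa using hdvd)

/-- The column statement for a prime `p`. -/
theorem not_prime_dvd_both_of_det {α β γ δ : ℤ} {ε : ℤ} (hε : ε = 1 ∨ ε = -1)
    (h : α * δ - β * γ = ε) {p : ℕ} (hp : p.Prime) : ¬ ((p : ℤ) ∣ α ∧ (p : ℤ) ∣ γ) :=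
  not_dvd_both_of_det hε h (by
    rw [Int.isUnit_iff]
    have := hp.two_le
    omega)

end Unimodular

section NegativeExponents

variable {R : Type*} [CommRing R]

/-- Negative exponents (rows of the inverse chart matrix may be negative): for a unit `u`,
`u^(-n) − 1 = −u^(-n) · (u^n − 1)`, so `(1+ξ)^c − 1` and `(1+ξ)^|c| − 1` generate the same ideal. -/
theorem units_inv_pow_sub_one (u : Rˣ) (n : ℕ) :
    ((u⁻¹ ^ n : Rˣ) : R) - 1 = -((u⁻¹ ^ n : Rˣ) : R) * ((u : R) ^ n - 1) := by
  have h : ((u⁻¹ ^ n : Rˣ) : R) * (u : R) ^ n = 1 := by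
    rw [← Units.val_pow_eq_pow_val, ← Units.val_mul, inv_pow, inv_mul_cancel, Units.val_one]
  linear_combination h

end NegativeExponents

end Summit.ResolutionOfSingularities.ResolutionOfSingularities.Theorems.SoloBlind
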